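import Summits.BirchSwinnertonDyer.BirchSwinnertonDyer.Theorems.ManinLocalTwoThreeShimuraEisenstein
import HarnessLib

/-!
# LEVEL `52 = 4·13` (genus `5`): `¬ ShimuraIndexPrimeTo 2 D.f` FROM THE X₀(52) HECKE DATUM — the first genus-`> 1` lower bound
Summit `BirchSwinnertonDyer`, route `ManinLocalTwoThree` (cell bsd-f2-manin, es lens, gen 45, turnkey T-es-106 part 2; CANDIDATES row E-es-254),
crux C2 `ManinOddAtFour` (stmt-BirchSwinnertonDyer-22967).  Sequel to `…ShimuraEisenstein.lean` (THEOREM A: covering classes are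
Eisenstein, `φ(T_ℓ^∨x) = (ℓ + 1)φ(x)`; THEOREM B: a transparent separator makes `φ` kill the period kernel of `f`).

* `charThirteen`, `exists_shimuraHom_fiftyTwo`: the `2`-primary class `φ₁₃ = [(d | 13) = −1] : H₁(X₀(52), ℤ) →+ ℤ/2` (landed
  `exists_shimuraHom_of_four_dvd`, `q = 13 ≡ 1 mod 4`); `gammaFifteen = (7 2; 52 15)` has `φ₁₃({∞, γ₁₅∞}) = 1`.
* `separatorFiftyTwo = (T₃ − 1) ∘ (T₃ + 3)` and `transparent_separatorFiftyTwo`: transparent with the ODD multiplier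
  `(3 + 1 − 1)(3 + 1 + 3) = 21`.
* **`not_shimuraIndexPrimeTo_two_fiftyTwo_of_heckeDatum`**: for every `X₀(52)`-datum `D` (any elliptic curve of conductor `52` with its
  newform `f_D`): **`(T₃ − 1)(T₃ + 3)·S₂(Γ₀(52)) ⊆ ℂ·f_D ⇒ ¬ ShimuraIndexPrimeTo 2 D.f`**.  The hypothesis is the X₀(52) HECKE DATUM
  «`S₂(Γ₀(52)) = ℂ·52a ⊕ Old(26a) ⊕ Old(26b)` with `a₃ = 0, 1, −3`» (Cremona 1997, Tables 3 and 5: `26A: a₃ = 1`, `26B: a₃ = −3`,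
  `52A: a₃ = 0`; `T₃` commutes with both degeneracy maps since `3 ∤ 52`), under which `(T₃ − 1)(T₃ + 3)` kills the old space and is
  `−3 ≠ 0` on the new line.  BC5: E15-LATTICE-INDEX-v1 row `52a1`, index `[Λ₀ : Λ₁] = 2` ✓ (eclib).  Why `52` and not `40, 48, 64, 80`
  (the other genus-`> 1` rows of index `2`): their old constituents `20a, 24a, 32a, 40a` are Eisenstein mod `2` (rational `2`-torsion),
  so every transparent separator has an EVEN multiplier; at `52` the old forms `26a` (torsion `ℤ/3`) and `26b` (torsion `ℤ/7`) are not.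

Kernel-checked, standard axioms, no Literature fact consumed; beyond print: NO (Ling–Oesterlé 1991 Thm. 1 computes `Σ(52)`; the
period-lattice index is Cremona-table folklore) — new in the tree: a genus-`> 1` LOWER bound for the Shimura index, conditional only on
an explicit finite Hecke datum.

References: [LingOesterle1991] §1, Thm. 1; [Ribet1988Shimura] Thm. 1, §3; [CremonaAlgorithms1997] §2.4, Tables 3, 5; [Mazur1977] §II.11.
-/

set_option autoImplicit false

noncomputable section

-- justification: the `Summit.BirchSwinnertonDyer.BirchSwinnertonDyer.…` path repeats a component (route-file convention)
set_option linter.dupNamespace false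

open scoped Classical MatrixGroups

open CongruenceSubgroup Matrix.SpecialLinearGroup ModularGroup
open Literature.NumberTheory.EllipticCurves.ModularForms
open Summit.BirchSwinnertonDyer.BirchSwinnertonDyer.Theorems.ManinLocalTwoThree.ShimuraClass
open Summit.BirchSwinnertonDyer.Rank1Residual.ManinAdditive.KatoCurve (ShimuraIndexPrimeTo)

namespace Summit.BirchSwinnertonDyer.BirchSwinnertonDyer.Theorems.ManinLocalTwoThree.ShimuraEisenstein

/-- `χ₁₃` = the Legendre symbol mod `13` read additively in `ℤ/2` (`0` on `0` and on the squares `x⁶ = 1`, `1` on the non-squares).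
[folklore] -/
def charThirteen (x : ZMod 13) : ZMod 2 := if x = 0 ∨ x ^ 6 = 1 then 0 else 1

/-- `χ₁₃` is additive on units. [folklore] -/
theorem charThirteen_mul : ∀ x x' y y' : ZMod 13, x * x' = 1 → y * y' = 1 →
    charThirteen (x * y) = charThirteen x + charThirteen y := by
  decide

/-- `χ₁₃` is even (`13 ≡ 1 mod 4`). [folklore] -/
theorem charThirteen_neg : ∀ x : ZMod 13, charThirteen (-x) = charThirteen x := by decide

/-- **The `2`-primary Shimura class at level `52`**: `φ₁₃ : H₁(X₀(52), ℤ) →+ ℤ/2`, `φ₁₃({∞, k∞}) = [(d_k | 13) = −1]` (landed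
`exists_shimuraHom_of_four_dvd`, `q = 13`). [cite: LingOesterle1991, Thm. 1] -/
theorem exists_shimuraHom_fiftyTwo : ∃ φ : periodHomology 52 →+ ZMod 2, ∀ k : Gamma0 52,
    φ ⟨periodFunctional 52 k, periodFunctional_mem_periodHomology 52 k⟩ = charThirteen ((((k : SL(2, ℤ)) 1 1 : ℤ) : ZMod 13)) :=
  exists_shimuraHom_of_four_dvd (by norm_num) (by norm_num) (by norm_num) charThirteen charThirteen_mul charThirteen_neg
    (by decide)

/-- `γ₁₅ = (7 2; 52 15) ∈ Γ₀(52)`; `15 ≡ 2 (mod 13)` is a non-square. [folklore] -/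
def gammaFifteen : Gamma0 52 :=
  ⟨⟨!![7, 2; 52, 15], by rw [Matrix.det_fin_two_of]; norm_num⟩, by
    rw [Gamma0_mem]
    show (((52 : ℤ) : ZMod 52)) = 0
    decide⟩

/-- **The separator at level `52`**: `t₅₂ = (T₃ − 1) ∘ (T₃ + 3)` — it kills the old space `Old(26a) ⊕ Old(26b)` (`a₃ = 1, −3`) and
maps `S₂(Γ₀(52))` into the new line `ℂ·52a` (`a₃(52a) = 0`) by the X₀(52) Hecke datum. [cite: CremonaAlgorithms1997, §2.4 and Table 3] -/
def separatorFiftyTwo : Module.End ℂ (CuspForm (Gamma0 52) 2) :=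
  (heckeT (Gamma0 52) 2 3 - ((1 : ℤ) : ℂ) • 1) ∘ₗ (heckeT (Gamma0 52) 2 3 - ((-3 : ℤ) : ℂ) • 1)

/-- **`t₅₂` is Eisenstein-transparent with the ODD multiplier `(3 + 1 + 3)·(3 + 1 − 1) = 21`** for every class vanishing on `Γ₁(52)`.
[cite: Ribet1988Shimura, Thm. 1 and §3] -/
theorem transparent_separatorFiftyTwo {R : Type} [AddCommGroup R] (φ : periodHomology 52 →+ R) (v : Gamma0 52 → R)
    (hφ : ∀ k : Gamma0 52, φ ⟨periodFunctional 52 k, periodFunctional_mem_periodHomology 52 k⟩ = v k)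
    (hv : ∀ γ₁ : Gamma1 52, v ⟨(γ₁ : SL(2, ℤ)), Gamma1_in_Gamma0 52 γ₁.2⟩ = 0) :
    ∃ m : ∀ x ∈ periodHomology 52, separatorFiftyTwo.dualMap x ∈ periodHomology 52,
      ∀ (x : Module.Dual ℂ (CuspForm (Gamma0 52) 2)) (hx : x ∈ periodHomology 52),
        φ ⟨separatorFiftyTwo.dualMap x, m x hx⟩ = ((((3 : ℕ) : ℤ) + 1 - (-3)) * ((((3 : ℕ) : ℤ) + 1 - 1))) • φ ⟨x, hx⟩ := by
  obtain ⟨m₁, e₁⟩ := transparent_heckeT_sub φ v hφ hv Nat.prime_three (by norm_num : ¬ 3 ∣ 52) 1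
  obtain ⟨m₂, e₂⟩ := transparent_heckeT_sub φ v hφ hv Nat.prime_three (by norm_num : ¬ 3 ∣ 52) (-3)
  exact transparent_comp φ m₁ e₁ m₂ e₂

/-- **`¬ ShimuraIndexPrimeTo 2 f` AT LEVEL `52` for every `f` separated by `t₅₂` with `2Λ₀(f) ⊆ Λ₁(f)`** (witness `{∞, γ₁₅∞}_f`).
[cite: LingOesterle1991, Thm. 1] -/
theorem not_shimuraIndexPrimeTo_two_fiftyTwo (f : CuspForm (Gamma0 52) 2)
    (hsep : ∀ g : CuspForm (Gamma0 52) 2, ∃ c : ℂ, separatorFiftyTwo g = c • f)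
    (h2 : ∀ z ∈ periodLattice f, (2 : ℂ) * z ∈ periodLatticeGamma1 f) : ¬ ShimuraIndexPrimeTo 2 f := by
  obtain ⟨φ, hφ⟩ := exists_shimuraHom_fiftyTwo
  have hv : ∀ γ₁ : Gamma1 52, charThirteen (((((⟨(γ₁ : SL(2, ℤ)), Gamma1_in_Gamma0 52 γ₁.2⟩ : Gamma0 52) : SL(2, ℤ)) 1 1 :
      ℤ) : ZMod 13)) = 0 := fun γ₁ ↦ char_apply_gamma1 (by norm_num) charThirteen (by decide) γ₁
  obtain ⟨m, e⟩ := transparent_separatorFiftyTwo φ _ hφ hv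
  refine not_shimuraIndexPrimeTo_two_of_transparent_separator φ _ hφ hv f m e (by decide) hsep gammaFifteen ?_ h2
  rw [show (((gammaFifteen : SL(2, ℤ)) 1 1 : ℤ)) = 15 from rfl]
  decide

/-- **E-es-254 FROM THE X₀(52) HECKE DATUM.**  For every `X₀(52)`-datum `D` (any elliptic curve of conductor `52` with its newform
`f = f_D`): **`(T₃ − 1)(T₃ + 3)·S₂(Γ₀(52)) ⊆ ℂ·f ⇒ ¬ ShimuraIndexPrimeTo 2 D.f`** — the Shimura index `[Λ₀(f) : Λ₁(f)]` is EVEN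
(E15 row `52a1`: index `2`; the hypothesis is Cremona's Table 3: `S₂(Γ₀(52)) = ℂ·52a ⊕ Old(26a) ⊕ Old(26b)`, `a₃ = 0, 1, −3`).
The first genus-`> 1` lower bound for the Shimura index in the tree. [cite: CremonaAlgorithms1997, Tables 3 and 5] [cite: LingOesterle1991, Thm. 1] -/
theorem not_shimuraIndexPrimeTo_two_fiftyTwo_of_heckeDatum (W : WeierstrassCurve ℚ) [W.IsElliptic]
    (D : ModularParametrizationData W 52)
    (hsep : ∀ g : CuspForm (Gamma0 52) 2, ∃ c : ℂ, separatorFiftyTwo g = c • D.f) : ¬ ShimuraIndexPrimeTo 2 D.f :=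
  not_shimuraIndexPrimeTo_two_fiftyTwo D.f hsep fun _ hz ↦ two_mul_mem_periodLatticeGamma1_of_four_dvd D (by norm_num) hz

end Summit.BirchSwinnertonDyer.BirchSwinnertonDyer.Theorems.ManinLocalTwoThree.ShimuraEisenstein
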